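import Mathlib
import Summits.CriticalPhenomena.SAWScalingLimit.Theorems.SAWRestrictionRigidityAxiomsOfLimitMarkovClockParam
import Summits.CriticalPhenomena.SAWScalingLimit.Theorems.SAWRestrictionRigidityAxiomsOfLimitMarkovPathKernel
import Literature.Probability.RandomPlanarGeometry.ChordalCurveFamilyProofs
import Literature.Probability.RandomPlanarGeometry.CurveClassStopAtMeasurable
import HarnessLib

/-!
# The soft-Markov theorem on curve classes (soft-Markov brick E2b)

Crux `AxiomsOfLimit` (stmt-CriticalPhenomena-1370), line `registered`, stub `stub_markovOfLimit`,
soft-Markov theorem on curve classes (E2b, the capstone of the `markov` clause; lead c4). Theorems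
only.

Every probability law `μ` on planar curve classes carried by simple curves inside a ball, from `a`
to `b ≠ a`, admits ONE map `Q : CurveClass ℂ → Measure (CurveClass ℂ)` with `Q (trivial past) = μ`
and the Markov disintegration
`μ (stopAt F ⁻¹' S ∩ startFrom F ⁻¹' T) = ∫⁻ γ in stopAt F ⁻¹' S, Q (γ.stopAt F) T ∂μ`
for EVERY closed `F` (`stub_softMarkovAllF`). Proof: transport of the path-level theorem — the one
kernel `K` for all hitting times on path space, `exists_pathKernel` (p162310) — through the clock
parametrisation `Λ` of simple classes (`stub_clockParam`, p162730): `Λ` is a Borel representative map,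
and it is LOCAL (`Λ (c.stopAt F)` is `Λ c` stopped at its hitting parameter of `F`, itself an
`F`-independent function `u` of the past), so `Q p := (K (u p, Λ p)).map (future class)` (overridden
at the trivial past by `μ`, and at pasts already ending at `b` by the Dirac mass at the constant class
`b`) serves every closed `F ∌ a`; for `F ∋ a` the past is trivial and the future is the whole class.

References: G. F. Lawler, O. Schramm, W. Werner, Acta Math. 187 (2001), §2; O. Schramm, Israel J.
Math. 118 (2000), §1 (domain Markov property); C. Dellacherie, P.-A. Meyer, *Probabilités et
potentiel* B, VI.43–45 (prediction at announceable times). All [folklore].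
-/

noncomputable section

open MeasureTheory ProbabilityTheory Filter Topology Set Metric
open scoped ENNReal

namespace Summit.CriticalPhenomena.SAWScalingLimit.Theorems.AxiomsOfLimitMarkov

open Literature.Probability.RandomPlanarGeometry

/-- The path `ω` stopped at real time `t`: `u ↦ ω (min u (projIcc t))`. [folklore] -/
local notation3 "stp[" t ", " ω "]" =>
  ContinuousMap.comp ω (ContinuousMap.id unitInterval ⊓
    ContinuousMap.const unitInterval (Set.projIcc (0:ℝ) 1 zero_le_one t))

/-- The hitting parameter of `F` by the path `ω`. [folklore] -/
local notation3 "hit[" F ", " ω "]" => Curve.hitParam F (Curve.mk ω)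

/-- The pair (hitting parameter of `F`, path stopped there). [folklore] -/
local notation3 "XF[" F ", " ω "]" => (hit[F, ω], stp[hit[F, ω], ω])

/-- The class of the head of the path `ω` up to real time `r`. [folklore] -/
local notation3 "past[" r ", " ω "]" =>
  CurveClass.mk (Curve.mk (ContinuousMap.comp ω (Curve.affineClamp 0 r)))

/-- The class of the tail of the path `ω` from real time `r` on. [folklore] -/
local notation3 "fut[" r ", " ω "]" =>
  CurveClass.mk (Curve.mk (ContinuousMap.comp ω (Curve.affineClamp r (1 - r))))

/-! ### Transport lemmas -/

/-- The clock parametrisation `Λ` of `stub_clockParam`, with its clock read as an `F`-independent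
function `u` of the past: `Λ` is Borel, represents simple classes in the ball, and for a simple class
`c` in the ball meeting the closed set `F`, `Λ (c.stopAt F)` is `Λ c` stopped at its hitting
parameter of `F`, which equals `u (c.stopAt F)`. [folklore] -/
theorem SoftMarkov.exists_clockParam [MeasurableSpace C(unitInterval, ℂ)]
    [BorelSpace C(unitInterval, ℂ)] {R : ℝ} (hR : 0 < R) :
    ∃ (u : CurveClass ℂ → ℝ) (Λ : CurveClass ℂ → C(unitInterval, ℂ)), Measurable Λ ∧
      (∀ c ∈ CurveClass.simple, c.range ⊆ ball (0:ℂ) R → CurveClass.mk (Curve.mk (Λ c)) = c) ∧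
      (∀ c ∈ CurveClass.simple, c.range ⊆ ball (0:ℂ) R → ∀ F : Set ℂ, IsClosed F →
        (c.range ∩ F).Nonempty →
          Λ (c.stopAt F) = stp[hit[F, Λ c], Λ c] ∧ u (c.stopAt F) = hit[F, Λ c]) := by
  obtain ⟨Λ, hΛm, hrep, -, hloc⟩ := stub_clockParam R hR
  have hW : (volume (closedBall (0:ℂ) R)).toReal ≠ 0 :=
    (ENNReal.toReal_pos (Metric.measure_closedBall_pos volume (0:ℂ) hR).ne'
      measure_closedBall_lt_top.ne).ne'
  refine ⟨fun p => ((∫ x in closedBall (0:ℂ) R, Real.exp (-infDist x p.range)) -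
      ∫ x in closedBall (0:ℂ) R, Real.exp (-infDist x (CurveClass.mk (Curve.const p.source)).range)) /
      (volume (closedBall (0:ℂ) R)).toReal, Λ, hΛm, hrep, fun c hc hcR F hF hne => ?_⟩
  obtain ⟨h1, h2⟩ := hloc c hc hcR F hF hne
  refine ⟨h1, ?_⟩
  beta_reduce
  rw [CurveClass.source_stopAt, ← h2, mul_div_cancel_right₀ _ hW]

/-- The head up to `ρ ≥ 0` of the path stopped at `ρ` is the head of the path. [folklore] -/
theorem SoftMarkov.stop_comp_affineClamp {ρ : ℝ} (hρ : 0 ≤ ρ) (ω : C(unitInterval, ℂ)) :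
    (stp[ρ, ω]).comp (Curve.affineClamp 0 ρ) = ω.comp (Curve.affineClamp 0 ρ) := by
  refine ContinuousMap.ext fun s => ?_
  simp only [ContinuousMap.comp_apply, ContinuousMap.inf_apply, ContinuousMap.id_apply,
    ContinuousMap.const_apply, Curve.affineClamp_apply, zero_add]
  rw [inf_of_le_left (Set.monotone_projIcc zero_le_one (mul_le_of_le_one_right hρ s.2.2))]

/-- Past and future of the class of a path at a closed set: the classes of the head of the STOPPED
path up to the hitting parameter, and of the tail of the path from there. [folklore] -/
theorem SoftMarkov.stopAt_mk_mk {F : Set ℂ} (hF : IsClosed F) (γ : C(unitInterval, ℂ)) :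
    (CurveClass.mk (Curve.mk γ)).stopAt F = past[hit[F, γ], stp[hit[F, γ], γ]] ∧
      (CurveClass.mk (Curve.mk γ)).startFrom F = fut[hit[F, γ], γ] := by
  rw [SoftMarkov.stop_comp_affineClamp ((Curve.mk γ).hitParam_mem_Icc F).1]
  exact ⟨CurveClass.stopAt_mk_holds F hF _, CurveClass.startFrom_mk_holds F hF _⟩

/-- A simple class whose past at a closed set already ends at the target of the class has the
trivial future, the constant class at the target. [folklore] -/
theorem SoftMarkov.startFrom_eq_of_target_stopAt {F : Set ℂ} (hF : IsClosed F)
    {c : CurveClass ℂ} (hc : c ∈ CurveClass.simple) (h : (c.stopAt F).target = c.target) :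
    c.startFrom F = CurveClass.mk (Curve.const c.target) := by
  obtain ⟨γ, hγ, rfl⟩ := hc
  have hinj : Function.Injective γ := hγ
  rw [CurveClass.stopAt_mk_holds F hF, CurveClass.target_mk, CurveClass.target_mk,
    Curve.target_stopAt, Curve.target_def] at h
  have h1 : γ.hitParam F = 1 := congrArg Subtype.val (hinj h)
  rw [CurveClass.startFrom_mk_holds F hF, Curve.startFrom_eq_const_of_hitParam_eq_one h1,
    CurveClass.target_mk]

/-- The past at a closed set `F ∌ a` of a class not ending at `a` does not end at `a`: it ends in
`F`, or it is the whole class. [folklore] -/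
theorem SoftMarkov.target_stopAt_ne {F : Set ℂ} (hF : IsClosed F) {a : ℂ} (haF : a ∉ F)
    {c : CurveClass ℂ} (hc : c.target ≠ a) : (c.stopAt F).target ≠ a := by
  obtain ⟨γ, rfl⟩ := CurveClass.surjective_mk c
  rw [CurveClass.stopAt_mk_holds F hF, CurveClass.target_mk, Curve.target_stopAt]
  by_cases h : ∃ t, γ t ∈ F
  · exact fun h' => haF (h' ▸ Curve.apply_hitParam_mem hF h)
  · push Not at h
    have h1 : (⟨γ.hitParam F, γ.hitParam_mem_Icc F⟩ : unitInterval) = 1 :=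
      Subtype.ext (Curve.hitParam_eq_one_of_forall_notMem h)
    rw [h1]
    exact hc

/-- A class whose past at a closed set `F` does not end where the class ends meets `F`.
[folklore] -/
theorem SoftMarkov.nonempty_of_target_stopAt_ne {F : Set ℂ} (hF : IsClosed F)
    {c : CurveClass ℂ} (h : (c.stopAt F).target ≠ c.target) : (c.range ∩ F).Nonempty := by
  obtain ⟨γ, rfl⟩ := CurveClass.surjective_mk c
  by_contra h0
  refine h ?_
  rw [CurveClass.stopAt_mk_holds F hF, Curve.stopAt_eq_self_of_hitParam_eq_one]
  exact Curve.hitParam_eq_one_of_forall_notMem fun t ht => h0 ⟨γ t, ⟨t, rfl⟩, ht⟩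

/-- A curve starting in the closed set `F` has the constant class at its start as past and its
own class as future. [folklore] -/
theorem SoftMarkov.stopAt_mk_of_mem {F : Set ℂ} (hF : IsClosed F) (γ : Curve ℂ) (h : γ 0 ∈ F) :
    (CurveClass.mk γ).stopAt F = CurveClass.mk (Curve.const (γ 0)) ∧
      (CurveClass.mk γ).startFrom F = CurveClass.mk γ := by
  have h0 : γ.hitParam F = 0 :=
    le_antisymm (by simpa using Curve.hitParam_le h) (γ.hitParam_mem_Icc F).1
  rw [CurveClass.stopAt_mk_holds F hF, CurveClass.startFrom_mk_holds F hF]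
  refine ⟨congrArg _ (Curve.ext (ContinuousMap.ext fun s => ?_)),
    congrArg _ (Curve.ext (ContinuousMap.ext fun s => ?_))⟩
  · show γ.stopAt F s = γ 0
    rw [Curve.stopAt_apply, h0, zero_mul, Set.projIcc_left]
    rfl
  · show γ.startFrom F s = γ s
    rw [Curve.startFrom_apply, h0, zero_add, sub_zero, one_mul, Set.projIcc_val]

/-- A probability measure carried by `{g = z}` gives `{g ∈ T}` the mass `1_T (z)`. [folklore] -/
theorem SoftMarkov.measure_setOf_mem_eq_indicator {α β : Type*} [MeasurableSpace α]
    {ν : Measure α} [IsProbabilityMeasure ν] {g : α → β} {z : β} (h : ν {y | g y ≠ z} = 0)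
    (T : Set β) : ν {y | g y ∈ T} = T.indicator 1 z := by
  by_cases hz : z ∈ T
  · rw [Set.indicator_of_mem hz, Pi.one_apply, ← measure_univ (μ := ν)]
    have hsub : {y | g y ∈ T}ᶜ ⊆ {y | g y ≠ z} := fun y hy hyz => hy (show g y ∈ T by rwa [hyz])
    exact measure_congr (ae_eq_univ.2 (measure_mono_null hsub h))
  · rw [Set.indicator_of_notMem hz]
    have hsub : {y | g y ∈ T} ⊆ {y | g y ≠ z} := fun y hy hyz => hz (show z ∈ T by rwa [← hyz])
    exact measure_mono_null hsub h

/-- `(r, ω) ↦ past[r, ω]` and `(r, ω) ↦ fut[r, ω]` are continuous on `ℝ × C([0,1], ℂ)`.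
[folklore] -/
theorem SoftMarkov.continuous_past_fut :
    (Continuous fun p : ℝ × C(unitInterval, ℂ) => past[p.1, p.2]) ∧
      Continuous fun p : ℝ × C(unitInterval, ℂ) => fut[p.1, p.2] :=
  ⟨CurveClass.continuous_mk_comp_mk.comp (ContinuousMap.continuous_comp'.comp
      (((Curve.continuous_affineClamp continuous_const continuous_id).comp continuous_fst).prodMk
        continuous_snd)),
    CurveClass.continuous_mk_comp_mk.comp (ContinuousMap.continuous_comp'.comp
      (((Curve.continuous_affineClamp continuous_id (continuous_const.sub continuous_id)).comp
        continuous_fst).prodMk continuous_snd))⟩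

/-! ### The theorem -/

/-- **The soft-Markov theorem on curve classes (registered stub `stub_softMarkovAllF`).** Given
the path-level theorem (hypothesis; the proof uses the landed, stronger `exists_pathKernel`), every
probability law on planar curve classes carried by simple curves in `ball 0 R` from `a` to `b ≠ a`
has ONE Markov kernel `Q` on classes, with `Q (mk (const a)) = μ`, disintegrating `μ` along
`(stopAt F, startFrom F)` for EVERY closed set `F`. [folklore] -/
theorem stub_softMarkovAllF : (∀ [MeasurableSpace C(unitInterval, ℂ)] [BorelSpace C(unitInterval, ℂ)] (μ : MeasureTheory.Measure C(unitInterval, ℂ)) [MeasureTheory.IsFiniteMeasure μ] (a : ℂ), Filter.Eventually (fun ω : C(unitInterval, ℂ) => ω 0 = a) (MeasureTheory.ae μ) → ∃ K : ℝ × C(unitInterval, ℂ) → MeasureTheory.Measure C(unitInterval, ℂ), ∀ F : Set ℂ, IsClosed F → a ∉ F → ∀ E : Set ((ℝ × C(unitInterval, ℂ)) × C(unitInterval, ℂ)), MeasurableSet E → μ {ω : C(unitInterval, ℂ) | ((((Literature.Probability.RandomPlanarGeometry.Curve.mk (ω)).hitParam F), ((ω).comp (ContinuousMap.id unitInterval ⊓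 ContinuousMap.const unitInterval (Set.projIcc (0:ℝ) 1 zero_le_one (((Literature.Probability.RandomPlanarGeometry.Curve.mk (ω)).hitParam F)))))), ω) ∈ E} = MeasureTheory.lintegral μ (fun ω : C(unitInterval, ℂ) => K (((Literature.Probability.RandomPlanarGeometry.Curve.mk (ω)).hitParam F), ((ω).comp (ContinuousMap.id unitInterval ⊓ ContinuousMap.const unitInterval (Set.projIcc (0:ℝ) 1 zero_le_one (((Literature.Probability.RandomPlanarGeometry.Curve.mk (ω)).hitParam F)))))) {y : C(unitInterval, ℂ) | ((((Literature.Probability.RandomPlanarGeometry.Curve.mk (ω)).hitParam F), ((ω).comp (ContinuousMap.id unitInterval ⊓ ContinuousMap.const unitInterval (Set.projIcc (0:ℝ) 1 zero_le_one (((Literature.Probability.RandomPlanarGeometry.Curve.mk (ω)).hitParam F)))))), y) ∈ E})) → ∀ (μ : MeasureTheory.Measure (Literature.Probability.RandomPlanarGeometry.CurveClass ℂ)) [MeasureTheory.IsProbabilityMeasure μ] (a b : ℂ) (R : ℝ), 0 < R → a ≠ b → Filter.Eventually (fun c : Literature.Probability.RandomPlanarGeometry.CurveClass ℂ => c ∈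 Literature.Probability.RandomPlanarGeometry.CurveClass.simple ∧ c.range ⊆ Metric.ball (0:ℂ) R ∧ c.source = a ∧ c.target = b) (MeasureTheory.ae μ) → ∃ Q : Literature.Probability.RandomPlanarGeometry.CurveClass ℂ → MeasureTheory.Measure (Literature.Probability.RandomPlanarGeometry.CurveClass ℂ), Q (Literature.Probability.RandomPlanarGeometry.CurveClass.mk (Literature.Probability.RandomPlanarGeometry.Curve.const a)) = μ ∧ ∀ F : Set ℂ, IsClosed F → ∀ S T : Set (Literature.Probability.RandomPlanarGeometry.CurveClass ℂ), MeasurableSet S → MeasurableSet T → μ (Literature.Probability.RandomPlanarGeometry.CurveClass.stopAt F ⁻¹' S ∩ Literature.Probability.RandomPlanarGeometry.CurveClass.startFrom F ⁻¹' T) = MeasureTheory.lintegral (μ.restrict (Literature.Probability.RandomPlanarGeometry.CurveClass.stopAt F ⁻¹' S)) (fun γ => Q (γ.stopAt F) T) := by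
  intro _ μ _ a b R hR hab hae
  classical
  letI : MeasurableSpace C(unitInterval, ℂ) := borel _
  haveI : BorelSpace C(unitInterval, ℂ) := ⟨rfl⟩
  -- the clock parametrisation, the transported law on paths, the path kernel
  obtain ⟨u, Λ, hΛm, hrep, hloc⟩ := SoftMarkov.exists_clockParam hR
  have hgood : ∀ᵐ c ∂μ, (c ∈ CurveClass.simple ∧ c.range ⊆ ball (0:ℂ) R) ∧
      CurveClass.mk (Curve.mk (Λ c)) = c ∧ c.source = a ∧ c.target = b :=
    hae.mono fun c h => ⟨⟨h.1, h.2.1⟩, hrep c h.1 h.2.1, h.2.2⟩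
  have hν0 : ∀ᵐ ω ∂(μ.map Λ), ω 0 = a := by
    refine (ae_map_iff hΛm.aemeasurable
      ((continuous_eval_const (0 : unitInterval)).measurable (measurableSet_singleton a))).2
      (hgood.mono fun c h => ?_)
    obtain ⟨-, hmk, hsrc, -⟩ := h
    show (Curve.mk (Λ c)) 0 = a
    rw [← hsrc]
    exact congrArg CurveClass.source hmk
  have hmono : Monotone fun t : ℝ => MeasurableSpace.comap (fun ω : C(unitInterval, ℂ) => stp[t, ω])
      (inferInstance : MeasurableSpace C(unitInterval, ℂ)) := fun s t hst => by
    have h : (fun ω : C(unitInterval, ℂ) => stp[s, ω]) =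
        (fun ω : C(unitInterval, ℂ) => stp[s, ω]) ∘ fun ω : C(unitInterval, ℂ) => stp[t, ω] :=
      funext fun ω => (comp_stop_of_le (Set.monotone_projIcc zero_le_one hst) ω).symm
    show MeasurableSpace.comap (fun ω : C(unitInterval, ℂ) => stp[s, ω]) _ ≤ _
    rw [h, ← MeasurableSpace.comap_comp]
    exact MeasurableSpace.comap_mono (measurable_stop _).comap_le
  obtain ⟨K, hK⟩ := exists_pathKernel ⟨_, hmono, fun t => (measurable_stop _).comap_le⟩
    (fun _ => rfl) (μ.map Λ) hν0
  -- the Markov kernel on classes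
  obtain ⟨Q, hQa, hQb, hQK⟩ : ∃ Q : CurveClass ℂ → Measure (CurveClass ℂ),
      Q (CurveClass.mk (Curve.const a)) = μ ∧
      (∀ p, p ≠ CurveClass.mk (Curve.const a) → p.target = b →
        Q p = Measure.dirac (CurveClass.mk (Curve.const b))) ∧
      (∀ p, p ≠ CurveClass.mk (Curve.const a) → p.target ≠ b →
        Q p = (K (u p, Λ p)).map fun y => fut[u p, y]) :=
    ⟨fun p => if p = CurveClass.mk (Curve.const a) then μ else if p.target = b then
        Measure.dirac (CurveClass.mk (Curve.const b)) else (K (u p, Λ p)).map fun y => fut[u p, y],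
      if_pos rfl, fun p h1 h2 => by simp [h1, h2], fun p h1 h2 => by simp [h1, h2]⟩
  refine ⟨Q, hQa, fun F hF S T hS hT => ?_⟩
  have hSm : MeasurableSet (CurveClass.stopAt F ⁻¹' S) := hS.preimage (CurveClass.measurable_stopAt hF)
  by_cases haF : a ∈ F
  · -- `a ∈ F`: the past is trivial and the future is the whole class
    have hAE : ∀ᵐ c ∂μ, c.stopAt F = CurveClass.mk (Curve.const a) ∧ c.startFrom F = c := by
      filter_upwards [hgood] with c h
      obtain ⟨-, hmk, hsrc, -⟩ := h
      have h0 : (Curve.mk (Λ c)) 0 = a := by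
        rw [← hsrc]
        exact congrArg CurveClass.source hmk
      obtain ⟨h1, h2⟩ := SoftMarkov.stopAt_mk_of_mem hF (Curve.mk (Λ c)) (by rw [h0]; exact haF)
      rw [← hmk, h1, h2, h0]
      exact ⟨rfl, rfl⟩
    have h1 : μ (CurveClass.stopAt F ⁻¹' S ∩ CurveClass.startFrom F ⁻¹' T) =
        μ ({c | CurveClass.mk (Curve.const a) ∈ S} ∩ T) :=
      measure_congr (eventuallyEq_set.2 (hAE.mono fun c h => by
        simp only [Set.mem_inter_iff, Set.mem_preimage, Set.mem_setOf_eq, h.1, h.2]))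
    have h2 : ∫⁻ c in CurveClass.stopAt F ⁻¹' S, Q (c.stopAt F) T ∂μ =
        ∫⁻ _ in CurveClass.stopAt F ⁻¹' S, μ T ∂μ :=
      setLIntegral_congr_fun_ae hSm (hAE.mono fun c h _ => by rw [h.1, hQa])
    have h3 : μ (CurveClass.stopAt F ⁻¹' S) = μ {c | CurveClass.mk (Curve.const a) ∈ S} :=
      measure_congr (eventuallyEq_set.2 (hAE.mono fun c h => by
        simp only [Set.mem_preimage, Set.mem_setOf_eq, h.1]))
    rw [h1, h2, setLIntegral_const, h3]
    by_cases hSa : CurveClass.mk (Curve.const a) ∈ S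
    · simp only [hSa, Set.setOf_true, Set.univ_inter, measure_univ, mul_one]
    · simp only [hSa, Set.setOf_false, Set.empty_inter, measure_empty, mul_zero]
  · -- `a ∉ F`: transport of the path kernel
    have hτ : Measurable fun ω : C(unitInterval, ℂ) => hit[F, ω] := Curve.measurable_hitParam_mk hF
    have hX : Measurable fun ω : C(unitInterval, ℂ) => XF[F, ω] :=
      hτ.prodMk (measurable_stop_random hτ)
    have hXid : Measurable fun ω : C(unitInterval, ℂ) => (XF[F, ω], id ω) := hX.prodMk measurable_id
    obtain ⟨hpc, hfc⟩ := SoftMarkov.continuous_past_fut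
    have hPm : Measurable fun p : (ℝ × C(unitInterval, ℂ)) × C(unitInterval, ℂ) =>
        past[p.1.1, p.1.2] := hpc.measurable.comp measurable_fst
    have hFm : Measurable fun p : (ℝ × C(unitInterval, ℂ)) × C(unitInterval, ℂ) =>
        fut[p.1.1, p.2] := hfc.measurable.comp (measurable_fst.fst.prodMk measurable_snd)
    have hfutm : ∀ r : ℝ, Measurable fun y : C(unitInterval, ℂ) => fut[r, y] := fun r =>
      hfc.measurable.comp (measurable_const.prodMk measurable_id)
    -- the conditional distribution of the path given (hitting time, stopped path)
    have hdis : ∀ s : Set ((ℝ × C(unitInterval, ℂ)) × C(unitInterval, ℂ)), MeasurableSet s →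
        ∫⁻ ω, condDistrib id (fun ω : C(unitInterval, ℂ) => XF[F, ω]) (μ.map Λ) XF[F, ω]
            {y | (XF[F, ω], y) ∈ s} ∂(μ.map Λ) =
          (μ.map Λ) ((fun ω : C(unitInterval, ℂ) => (XF[F, ω], id ω)) ⁻¹' s) := by
      intro s hs
      have h1 := Measure.compProd_apply (μ := (μ.map Λ).map fun ω : C(unitInterval, ℂ) => XF[F, ω])
        (κ := condDistrib id (fun ω : C(unitInterval, ℂ) => XF[F, ω]) (μ.map Λ)) hs
      rw [compProd_map_condDistrib aemeasurable_id, Measure.map_apply hXid hs,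
        lintegral_map (Kernel.measurable_kernel_prodMk_left hs) hX] at h1
      exact h1.symm
    have hκK : ∀ᵐ c ∂μ, condDistrib id (fun ω : C(unitInterval, ℂ) => XF[F, ω]) (μ.map Λ)
        XF[F, Λ c] = K XF[F, Λ c] := ae_of_ae_map hΛm.aemeasurable (hK F hF haF)
    have hprob : ∀ x, IsProbabilityMeasure
        (condDistrib id (fun ω : C(unitInterval, ℂ) => XF[F, ω]) (μ.map Λ) x) := fun x =>
      inferInstance
    have hmeasκ : ∀ s : Set ((ℝ × C(unitInterval, ℂ)) × C(unitInterval, ℂ)), MeasurableSet s →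
        Measurable fun ω : C(unitInterval, ℂ) =>
          condDistrib id (fun ω : C(unitInterval, ℂ) => XF[F, ω]) (μ.map Λ) XF[F, ω]
            {y | (XF[F, ω], y) ∈ s} := fun s hs =>
      (Kernel.measurable_kernel_prodMk_left hs).comp hX
    generalize condDistrib id (fun ω : C(unitInterval, ℂ) => XF[F, ω]) (μ.map Λ) = κ
      at hdis hκK hprob hmeasκ
    -- (k2): above a past ending at `b` the fibre sits on the trivial future
    have hk2 : ∀ᵐ ω ∂(μ.map Λ), (past[hit[F, ω], stp[hit[F, ω], ω]]).target = b →
        κ XF[F, ω] {y | fut[hit[F, ω], y] ≠ CurveClass.mk (Curve.const b)} = 0 := by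
      have hB : MeasurableSet {p : (ℝ × C(unitInterval, ℂ)) × C(unitInterval, ℂ) |
          (past[p.1.1, p.1.2]).target = b ∧ fut[p.1.1, p.2] ≠ CurveClass.mk (Curve.const b)} :=
        ((CurveClass.continuous_target.measurable.comp hPm) (measurableSet_singleton b)).inter
          (hFm (measurableSet_singleton _)).compl
      have h0 : ∫⁻ ω, κ XF[F, ω] {y | (XF[F, ω], y) ∈ {p : (ℝ × C(unitInterval, ℂ)) ×
          C(unitInterval, ℂ) | (past[p.1.1, p.1.2]).target = b ∧
            fut[p.1.1, p.2] ≠ CurveClass.mk (Curve.const b)}} ∂(μ.map Λ) = 0 := by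
        rw [hdis _ hB, Measure.map_apply hΛm (hXid hB)]
        refine measure_eq_zero_iff_ae_notMem.2 (hgood.mono fun c h hc => ?_)
        obtain ⟨⟨hcs, -⟩, hmk, -, htgt⟩ := h
        obtain ⟨h1, h2⟩ := SoftMarkov.stopAt_mk_mk hF (Λ c)
        rw [hmk] at h1 h2
        simp only [Set.mem_preimage, Set.mem_setOf_eq, id_eq] at hc
        refine hc.2 ?_
        rw [← h2, ← htgt]
        exact SoftMarkov.startFrom_eq_of_target_stopAt hF hcs (by rw [h1, hc.1, htgt])
      filter_upwards [(lintegral_eq_zero_iff (hmeasκ _ hB)).1 h0] with ω hω hb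
      rw [Pi.zero_apply] at hω
      rw [← hω]
      congr 1
      exact Set.ext fun y => by simp only [Set.mem_setOf_eq, hb, true_and]
    -- the common measurable integrand
    obtain ⟨M, hMdef⟩ : ∃ M : C(unitInterval, ℂ) → ℝ≥0∞, ∀ ω, M ω =
        if past[hit[F, ω], stp[hit[F, ω], ω]] ∈ S then
          (if (past[hit[F, ω], stp[hit[F, ω], ω]]).target = b then
            T.indicator 1 (CurveClass.mk (Curve.const b))
          else κ XF[F, ω] {y | fut[hit[F, ω], y] ∈ T}) else 0 := ⟨_, fun _ => rfl⟩
    have hMm : Measurable M := by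
      rw [funext hMdef]
      refine Measurable.ite (hS.preimage (hpc.measurable.comp hX))
        (Measurable.ite ?_ measurable_const (hmeasκ _ (hFm hT))) measurable_const
      exact (CurveClass.continuous_target.measurable.comp (hpc.measurable.comp hX))
        (measurableSet_singleton b)
    -- a.e. identifications on the class side
    have hAEμ : ∀ᵐ c ∂μ,
        (c ∈ CurveClass.stopAt F ⁻¹' S ∩ CurveClass.startFrom F ⁻¹' T ↔
          past[hit[F, Λ c], stp[hit[F, Λ c], Λ c]] ∈ S ∧ fut[hit[F, Λ c], Λ c] ∈ T) ∧
        (CurveClass.stopAt F ⁻¹' S).indicator (fun c => Q (c.stopAt F) T) c = M (Λ c) := by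
      filter_upwards [hgood, hκK] with c h hKc
      obtain ⟨⟨hcs, hcR⟩, hmk, -, htgt⟩ := h
      obtain ⟨h1, h2⟩ := SoftMarkov.stopAt_mk_mk hF (Λ c)
      rw [hmk] at h1 h2
      refine ⟨by simp only [Set.mem_inter_iff, Set.mem_preimage, h1, h2], ?_⟩
      rw [hMdef]
      by_cases hSc : c ∈ CurveClass.stopAt F ⁻¹' S
      · have hne : c.stopAt F ≠ CurveClass.mk (Curve.const a) := fun h =>
          SoftMarkov.target_stopAt_ne hF haF (htgt.trans_ne hab.symm) (by rw [h]; rfl)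
        rw [Set.indicator_of_mem hSc, ← h1, if_pos (Set.mem_preimage.1 hSc)]
        by_cases hb : (c.stopAt F).target = b
        · rw [if_pos hb, hQb _ hne hb, Measure.dirac_apply' _ hT]
        · obtain ⟨hΛp, hup⟩ := hloc c hcs hcR F hF
            (SoftMarkov.nonempty_of_target_stopAt_ne hF (by rwa [htgt]))
          rw [if_neg hb, hQK _ hne hb, hup, hΛp, Measure.map_apply (hfutm _) hT, ← hKc]
          rfl
      · rw [Set.indicator_of_notMem hSc, if_neg fun h => hSc (show c.stopAt F ∈ S by rwa [h1])]
    -- a.e. identification on the path side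
    have hAEν : ∀ᵐ ω ∂(μ.map Λ), κ XF[F, ω] {y | (XF[F, ω], y) ∈ {p : (ℝ × C(unitInterval, ℂ)) ×
        C(unitInterval, ℂ) | past[p.1.1, p.1.2] ∈ S ∧ fut[p.1.1, p.2] ∈ T}} = M ω := by
      filter_upwards [hk2] with ω hω
      rw [hMdef]
      by_cases hS' : past[hit[F, ω], stp[hit[F, ω], ω]] ∈ S
      · rw [if_pos hS', show {y | past[hit[F, ω], stp[hit[F, ω], ω]] ∈ S ∧ fut[hit[F, ω], y] ∈ T} =
            {y | fut[hit[F, ω], y] ∈ T} from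
          Set.ext fun y => by simp only [Set.mem_setOf_eq, hS', true_and]]
        by_cases hb : (past[hit[F, ω], stp[hit[F, ω], ω]]).target = b
        · rw [if_pos hb]
          haveI := hprob XF[F, ω]
          exact SoftMarkov.measure_setOf_mem_eq_indicator (hω hb) T
        · rw [if_neg hb]
      · rw [if_neg hS', show {y | past[hit[F, ω], stp[hit[F, ω], ω]] ∈ S ∧ fut[hit[F, ω], y] ∈ T} = ∅
          from Set.ext fun y => by
            simp only [Set.mem_setOf_eq, hS', false_and, Set.mem_empty_iff_false], measure_empty]
    have hA : MeasurableSet {p : (ℝ × C(unitInterval, ℂ)) × C(unitInterval, ℂ) |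
        past[p.1.1, p.1.2] ∈ S ∧ fut[p.1.1, p.2] ∈ T} := (hPm hS).inter (hFm hT)
    calc μ (CurveClass.stopAt F ⁻¹' S ∩ CurveClass.startFrom F ⁻¹' T)
        = μ (Λ ⁻¹' {ω | (XF[F, ω], ω) ∈ {p : (ℝ × C(unitInterval, ℂ)) × C(unitInterval, ℂ) |
            past[p.1.1, p.1.2] ∈ S ∧ fut[p.1.1, p.2] ∈ T}}) :=
          measure_congr (eventuallyEq_set.2 (hAEμ.mono fun c h => h.1))
      _ = ∫⁻ ω, κ XF[F, ω] {y | (XF[F, ω], y) ∈ {p : (ℝ × C(unitInterval, ℂ)) × C(unitInterval, ℂ) |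
            past[p.1.1, p.1.2] ∈ S ∧ fut[p.1.1, p.2] ∈ T}} ∂(μ.map Λ) := by
          rw [hdis _ hA, Measure.map_apply hΛm (hXid hA)]
          rfl
      _ = ∫⁻ ω, M ω ∂(μ.map Λ) := lintegral_congr_ae hAEν
      _ = ∫⁻ c, M (Λ c) ∂μ := lintegral_map hMm hΛm
      _ = ∫⁻ c, (CurveClass.stopAt F ⁻¹' S).indicator (fun c => Q (c.stopAt F) T) c ∂μ :=
          lintegral_congr_ae (hAEμ.mono fun c h => h.2.symm)
      _ = _ := lintegral_indicator hSm _

end Summit.CriticalPhenomena.SAWScalingLimit.Theorems.AxiomsOfLimitMarkov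

end
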